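import Summits.BirchSwinnertonDyer.Rank1Residual.X2.IsogenySelmerGroup
import Literature.NumberTheory.EllipticCurves.Rank1Residual.Typed.X2RankZeroCertificate
import Literature.NumberTheory.EllipticCurves.KummerMap
import Summits.BirchSwinnertonDyer.Rank1Residual.X2.RankOneHeegner
import HarnessLib

/-!
# X2 ∧ `r_an = 0`: `BSD(E,p)` from PUBLISHED theorems plus a `p`-ISOGENY-DESCENT CERTIFICATE
# `#Sel^{(φ)}(E/ℚ) = p^s` (cell `b2b-bsdres`, unit `b2b-bsdres-eisenstein-p2`, gen 24; the
# rank-`0` consumer of gen 24's `X2/IsogenySelmerGroup.lean`)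

HONEST FRAMING (run/shared/lean/b2b/bsd-rank1-residual/, verbatim in every file): the goal of the
cell is to DELETE the COMBINATION-SHAPED residual classes of the Birch–Swinnerton-Dyer formula for
ALL analytic-rank `≤ 1` elliptic curves over `ℚ` — "full BSD formula for every rank `≤ 1` curve in
class `C`" assembled STRICTLY from published theorems — so that the rank-`≤ 1` remainder becomes
exactly the CONSTRUCTION-SHAPED classes, which are TYPED (missing-input `Prop`s), NOT attempted.
This is not "finishing BSD". Research route; NO CLAIM BEYOND STATED CLASSES; nothing here changes a
label; nothing is booked; X2b stays CONSTRUCTION-SHAPED (its class-level residue is Mazur's main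
conjecture with `μ > 0` allowed). Theorems only (no definition, no named fact). NOT a class theorem:
the certificate is per curve (instrument output = EVIDENCE; the lane owns verdicts and engines).

WHAT. Gen 24's `X2/IsogenySelmerGroup.lean` proved, for a `K`-isogeny `φ : E → E'`,
`#Sel^{(φ)}(E/K) = p^s ∧ #E'(K̄)^{Γ_K} = N ≠ 0 ⇒ p^{s − v_p(N)} ∣ #Ш(E/K)`. Here:
* §1 Galois descent in the counting form the certificate needs: `(toGeomPoints W).range =
  invariants Γ_K E(K̄)` and **`natCard_invariants_geomPoints_eq : #E(K̄)^{Γ_K} = #E(K)`** (over any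
  perfect field; the tree's `mem_range_toGeomPoints_iff` + injectivity of `toGeomPoints`);
* §2 **`pow_sub_padicValNat_dvd_shaOrder_of_card_isogenySelmerGroup_of_card_point`**:
  `#Sel^{(φ)}(E/K) = p^s`, `#E'(K) = N ≠ 0` ⇒ `p^{s − v_p(N)} ∣ #Ш(E/K)` (number field `K`);
* §3 the X2 rank-`0` instances over `ℚ` (class predicate `ClassX2 W p`: `p` odd, `E[p]` reducible,
  multiplicative at `p`): **`bsdp_of_classX2_of_isogenySelmerCertificate`** — `r_an = 0`,
  `#Ш(E/ℚ)_an = q` with `ord_p q ≤ 2k`, a `ℚ`-isogeny `φ : E → E'`, `#Sel^{(φ)}(E/ℚ) = p^s`,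
  `#E'(ℚ) = N ≠ 0`, `2k − 1 ≤ s − v_p(N)` ⇒ `BSD(E,p)` — from Wuthrich 2014 Prop. 21 (`hW`),
  Cassels–Tate squareness (`hCT`), Gross–Zagier–Kolyvagin (`hGZK`), modularity (`hmod`), all
  PUBLISHED, through `Typed.X2.bsdp_of_missingInputAt` / `missingLowerBoundAt_of_casselsTate_of_pow_dvd`;
  and the census case `k = 1` (`#Ш_an = 9`, `p = 3`): `bsdp_of_classX2_of_isogenySelmerCertificate_one`
  (`ord_p q ≤ 2`, `v_p(N) < s`).
Use (N9 split residue, 83 cells at `p = 3`, `3 ∣ #Ш_an` on every curve of every class): for the member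
`E` with `ord_3 #Ш_an(E) = 2` and a `3`-isogeny `φ : E → E'` defined over `ℚ`, a two-engine
certificate `#Sel^{(φ)}(E/ℚ) = 3^s` with `s > v_3(#E'(ℚ))` closes `BSD(E,3)` (and, by Cassels,
`BSD(·,3)` on the isogeny class); Mazur's main conjecture at the pair then follows by the cell's
converse chain (`X2/RankZeroExact.mazurMainConjectureAt_of_bsdp_of_red`).

References: Silverman, *AEC*, VIII.§1, X.4.1–X.4.2, X.4.14; Wuthrich, Doc. Math. 19 (2014)
Prop. 21; Miller 2011 Def. 1.1; Schaefer–Stoll 2004 (isogeny descents);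
HOME/b2b-bsdres-eisenstein-p2/X2-LEDGER.md §3.
-/

noncomputable section
open scoped Classical
universe u

namespace Summit.BirchSwinnertonDyer.Rank1Residual.X2.IsogenySelmerCertificate

open WeierstrassCurve Literature.NumberTheory.EllipticCurves
  Literature.NumberTheory.EllipticCurves.Rank1Residual
  Literature.NumberTheory.EllipticCurves.Rank1Residual.Typed
  Literature.NumberTheory.EllipticCurves.Wuthrich2014
  Summit.BirchSwinnertonDyer.Rank1Residual.X2.TorsionComparison
  Summit.BirchSwinnertonDyer.Rank1Residual.X2.ConnectingHomomorphism
  Summit.BirchSwinnertonDyer.Rank1Residual.X2.IsogenySelmerGroup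

/-! ## §1. Galois descent, counting form -/

section Descent

variable {K : Type u} [Field K] (W : WeierstrassCurve K)

/-- **`E(K) ↪ E(K̄)` has image exactly the `Γ_K`-invariants** (perfect `K`): the tree's Galois
descent `mem_range_toGeomPoints_iff` restated for the subgroup `invariants Γ_K E(K̄)` of
`X2/TorsionComparison`. Silverman, *AEC*, VIII.§1. [folklore] -/
theorem range_toGeomPoints_eq_invariants [PerfectField K] :
    (toGeomPoints W).range = invariants (Field.absoluteGaloisGroup K) W.geomPoints := by
  ext Q
  rw [mem_invariants_iff, AddMonoidHom.mem_range]
  constructor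
  · rintro ⟨P, rfl⟩ σ
    exact smul_toGeomPoints W σ P
  · intro hQ
    exact exists_toGeomPoints_eq_of_forall_smul_eq W hQ

/-- **`#E(K̄)^{Γ_K} = #E(K)`** (perfect `K`; `Nat.card`, so both sides are `0` when infinite).
Silverman, *AEC*, VIII.§1. [folklore] -/
theorem natCard_invariants_geomPoints_eq [PerfectField K] :
    Nat.card (invariants (Field.absoluteGaloisGroup K) W.geomPoints) = Nat.card W.toAffine.Point := by
  rw [← range_toGeomPoints_eq_invariants W]
  exact (Nat.card_congr (AddMonoidHom.ofInjective (toGeomPoints_injective W)).toEquiv).symm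

end Descent

/-! ## §2. The certificate with `#E'(K)` -/

section Certificate

variable {K : Type u} [Field K] [NumberField K] {W W' : WeierstrassCurve K} [W.IsElliptic]
  [W'.IsElliptic]

/-- **A `p`-isogeny descent bounds `#Ш(E/K)` from below, with the torsion of the TARGET curve as the
only correction:** for a `K`-isogeny `φ : E → E'`, `#Sel^{(φ)}(E/K) = p^s` and `#E'(K) = N ≠ 0`
(`E'(K)` finite) give `p^{s − v_p(N)} ∣ #Ш(E/K)` — gen 24's
`pow_sub_padicValNat_dvd_shaOrder_of_card_isogenySelmerGroup` with `#E'(K̄)^{Γ_K} = #E'(K)`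
(`natCard_invariants_geomPoints_eq`; a number field is perfect). [cite: SilvermanAEC2009, X.4.1–4.2] -/
theorem pow_sub_padicValNat_dvd_shaOrder_of_card_isogenySelmerGroup_of_card_point
    (φ : Isogeny W W') {p s N : ℕ} [Fact p.Prime]
    (hS : Nat.card (isogenySelmerGroup φ) = p ^ s) (hN : Nat.card W'.toAffine.Point = N)
    (hN0 : N ≠ 0) : p ^ (s - padicValNat p N) ∣ W.shaOrder := by
  have hinv : Nat.card (invariants (Field.absoluteGaloisGroup K) W'.geomPoints) = N := by
    rw [natCard_invariants_geomPoints_eq, hN]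
  have h := pow_sub_padicValNat_dvd_shaOrder_of_card_isogenySelmerGroup φ hS
    (by rw [hinv]; exact hN0)
  rwa [hinv] at h

end Certificate

/-! ## §3. X2 ∧ `r_an = 0` over `ℚ`: `BSD(E,p)` from published theorems + the certificate -/

section RankZero

variable {W W' : WeierstrassCurve ℚ} [W.IsElliptic] [W.IsGloballyMinimal] [W'.IsElliptic]
  (p : ℕ) [Fact p.Prime]

/-- **X2 ∧ `r_an = 0`: `BSD(E,p)` from PUBLISHED theorems plus a `p`-isogeny-descent certificate.**
For a globally minimal `E/ℚ` with `ord_{s=1} L(E,s) = 0` and `(E,p)` in class X2 (`p` odd, `E[p]`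
reducible, multiplicative at `p`), `#Ш(E/ℚ)_an = q` with `ord_p q ≤ 2k`, a `ℚ`-isogeny
`φ : E → E'` with `#Sel^{(φ)}(E/ℚ) = p^s`, `#E'(ℚ) = N ≠ 0` and `2k − 1 ≤ s − v_p(N)`: Miller's
`BSD(E,p)`. Published inputs: Wuthrich 2014 Prop. 21 (`hW`, upper bound `ord_p #Ш ≤ ord_p #Ш_an`),
the Cassels–Tate pairing (`hCT`, `#Ш` is a square), Gross–Zagier–Kolyvagin (`hGZK`), modularity
(`hmod`); the certificate (`hS`, `hN`) is per curve — the output of an isogeny descent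
(Schaefer–Stoll). Chain: `p^{s − v_p N} ∣ #Ш` (§2) ⇒ `p^{2k−1} ∣ #Ш` ⇒ `MissingLowerBoundAt`
(`missingLowerBoundAt_of_casselsTate_of_pow_dvd`) ⇒ `X2.MissingInputAt` ⇒ `BSDp`
(`Typed.X2.bsdp_of_missingInputAt`). NOT a class theorem. [cite: Wuthrich2014, Prop. 21 (p. 400)]
[cite: SilvermanAEC2009, Thm. X.4.14 and X.4.1–4.2] [cite: Miller2011LMS, §1 and Def. 1.1] -/
theorem bsdp_of_classX2_of_isogenySelmerCertificate
    (hCT : exists_casselsTate_pairing (K := ℚ)) (hW : sha_dvd_analyticSha)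
    (hGZK : rank_eq_analyticRank_of_analyticRank_le_one) (hmod : hasEntireLFunction_rat)
    (hr : W.analyticRank = 0) (hX : ClassX2 W p) {q : ℚ} (hq : shaAn W = (q : ℂ)) {k : ℕ}
    (hv : padicValRat p q ≤ 2 * k) (φ : Isogeny W W') {s N : ℕ}
    (hS : Nat.card (isogenySelmerGroup φ) = p ^ s) (hN : Nat.card W'.toAffine.Point = N)
    (hN0 : N ≠ 0) (hk : 2 * k - 1 ≤ s - padicValNat p N) : BSDp W p := by
  have hdvd : p ^ (2 * k - 1) ∣ W.shaOrder :=
    (pow_dvd_pow p hk).trans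
      (pow_sub_padicValNat_dvd_shaOrder_of_card_isogenySelmerGroup_of_card_point φ hS hN hN0)
  refine Typed.X2.bsdp_of_missingInputAt hW hGZK hmod W p (by omega) hX ⟨fun _ ↦ ?_, fun h1 ↦ ?_⟩
  · exact missingLowerBoundAt_of_casselsTate_of_pow_dvd W p hCT (hGZK W (by omega)).2 hq hv hdvd
  · omega

/-- **The census case `k = 1`** (`#Ш(E/ℚ)_an` exactly divisible by `p²`, e.g. `#Ш_an = 9` at
`p = 3` on the N9 split residue): X2 ∧ `r_an = 0`, `ord_p #Ш_an ≤ 2`, a `ℚ`-isogeny `φ : E → E'`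
with `#Sel^{(φ)}(E/ℚ) = p^s`, `#E'(ℚ) = N ≠ 0`, `v_p(N) < s` ⇒ `BSD(E,p)`.
[cite: Wuthrich2014, Prop. 21 (p. 400)] [cite: SilvermanAEC2009, Thm. X.4.14 and X.4.1–4.2]
[cite: Miller2011LMS, §1 and Def. 1.1] -/
theorem bsdp_of_classX2_of_isogenySelmerCertificate_one
    (hCT : exists_casselsTate_pairing (K := ℚ)) (hW : sha_dvd_analyticSha)
    (hGZK : rank_eq_analyticRank_of_analyticRank_le_one) (hmod : hasEntireLFunction_rat)
    (hr : W.analyticRank = 0) (hX : ClassX2 W p) {q : ℚ} (hq : shaAn W = (q : ℂ))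
    (hv : padicValRat p q ≤ 2) (φ : Isogeny W W') {s N : ℕ}
    (hS : Nat.card (isogenySelmerGroup φ) = p ^ s) (hN : Nat.card W'.toAffine.Point = N)
    (hN0 : N ≠ 0) (hs : padicValNat p N < s) : BSDp W p :=
  bsdp_of_classX2_of_isogenySelmerCertificate p hCT hW hGZK hmod hr hX hq (k := 1)
    (by simpa using hv) φ hS hN hN0 (by omega)

/-- **Along the isogeny class** (Cassels: `BSD(·,p)` is isogeny-invariant, the registered fact
`bsdRHS_eq_of_isIsogenous` = `hCassels`; the cell's `X2.bsdp_of_isIsogenous_of_bsdp`): the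
certificate on ONE member `E` (as above) gives `BSD(E₀,p)` for every curve `E₀` isogenous to `E`
over `ℚ` — e.g. the optimal curve of the class.
[cite: Wuthrich2014, Prop. 21 (p. 400)] [cite: MilneADT2006, I.7.3] -/
theorem bsdp_of_isIsogenous_of_isogenySelmerCertificate_one
    (hCassels : bsdRHS_eq_of_isIsogenous) (hCT : exists_casselsTate_pairing (K := ℚ))
    (hW : sha_dvd_analyticSha) (hGZK : rank_eq_analyticRank_of_analyticRank_le_one)
    (hmod : hasEntireLFunction_rat) (W₀ : WeierstrassCurve ℚ) [W₀.IsElliptic]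
    [W₀.IsGloballyMinimal] (hiso : IsIsogenous W W₀)
    (hr : W.analyticRank = 0) (hX : ClassX2 W p) {q : ℚ} (hq : shaAn W = (q : ℂ))
    (hv : padicValRat p q ≤ 2) (φ : Isogeny W W') {s N : ℕ}
    (hS : Nat.card (isogenySelmerGroup φ) = p ^ s) (hN : Nat.card W'.toAffine.Point = N)
    (hN0 : N ≠ 0) (hs : padicValNat p N < s) : BSDp W₀ p :=
  X2.bsdp_of_isIsogenous_of_bsdp hCassels hGZK hmod W W₀ hiso p (by omega)
    (bsdp_of_classX2_of_isogenySelmerCertificate_one p hCT hW hGZK hmod hr hX hq hv φ hS hN hN0 hs)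

end RankZero

end Summit.BirchSwinnertonDyer.Rank1Residual.X2.IsogenySelmerCertificate

end
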